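import Mathlib

/-!
# Crux `BoundedResponseConverges` (stmt-AtomisticToContinuum-9141), line `escape-deficit-dichotomy` —
# Fekete with a SUMMABLE defect, part 1: block estimates (pure real analysis)

Support file for item `stmt-AtomisticToContinuum-9141`
(`Summit.AtomisticToContinuum.FouriersLaw.Theses.OddSectorIrreversibility.BoundedResponseConverges`). The series-law
suppliers of the crux and of its two stubs (`EscapeNonOscillation` 12238, `ConductanceLowerBound` 11749) landed so far
require a BOUNDED junction defect (`R (N+M) ≤ R N + R M + C`, 14041; `R N + R M − C ≤ R (N+M)`, 11748). The companion
files `…SummableDefectFekete.lean` / `…SummableDefectSeriesLaw.lean` relax this to any defect `φ (N+M)` with `φ ≥ 0`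
non-decreasing and `∑ₖ φ(2ᵏ)/2ᵏ < ∞` (de Bruijn–Erdős form of Fekete's lemma). This part holds the elementary block
estimates for a real sequence `b` with `b (n+m) ≤ b n + b m + φ (n+m)` on the index semigroup `{n, m ≥ 2}`:

* `dyadic_div_le_of_defect_subadditive` — `b (2ⁱm)/(2ⁱm) ≤ b m / m + Σ_{l<i} φ(2^{l+1}m)/(2^{l+1}m)`;
* `mul_le_of_defect_subadditive` — all multiples `q m`, `q < 2ᵏ`, by induction on the binary length of `q`
  (each new top bit costs one defect `φ (2^{k+1} m)`);
* `mul_div_le_of_defect_subadditive` — `b (q m)/(q m) ≤ b m / m + 3τ` when `τ` bounds the dyadic partial sums;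
* `div_le_of_defect_subadditive` — general `n` by Euclidean division: `b n / n ≤ b m / m + 3τ + C/n + φ n / n`
  for `n ≥ m + 2` (the registered helper sub-goal of this file).

References: M. Fekete, Math. Z. 17 (1923) 228–249; N. G. de Bruijn and P. Erdős, *Some linear and some quadratic
recursion formulas II*, Indag. Math. 14 (1952) 152–163 (Thm. 22–23: subadditivity with an error term `φ`,
`∑ φ(n)/n² < ∞`).
-/

noncomputable section

namespace Summit.AtomisticToContinuum.FouriersLaw.Theorems.EscapeDeficitDichotomy

open Filter Topology Set

/-! ## Fekete's lemma with a summable defect (de Bruijn–Erdős) on the index semigroup `{n ≥ 2}` -/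

/-- Dyadic blocks: if `b (n+m) ≤ b n + b m + φ (n+m)` on `{n, m ≥ 2}` then for `m ≥ 2` and every `i`,
`b (2ⁱ m) / (2ⁱ m) ≤ b m / m + Σ_{l < i} φ (2^{l+1} m) / (2^{l+1} m)` (induction on `i`). [folklore] -/
theorem dyadic_div_le_of_defect_subadditive {b φ : ℕ → ℝ}
    (hb : ∀ n m : ℕ, 2 ≤ n → 2 ≤ m → b (n + m) ≤ b n + b m + φ (n + m)) {m : ℕ} (hm : 2 ≤ m) (i : ℕ) :
    b (2 ^ i * m) / ((2 ^ i * m : ℕ) : ℝ) ≤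
      b m / (m : ℝ) + ∑ l ∈ Finset.range i, φ (2 ^ (l + 1) * m) / ((2 ^ (l + 1) * m : ℕ) : ℝ) := by
  induction i with
  | zero => simp
  | succ i ih =>
    have h2i : 2 ≤ 2 ^ i * m := le_trans hm (Nat.le_mul_of_pos_left m (Nat.two_pow_pos i))
    have hstep : b (2 ^ (i + 1) * m) ≤ 2 * b (2 ^ i * m) + φ (2 ^ (i + 1) * m) := by
      have h := hb (2 ^ i * m) (2 ^ i * m) h2i h2i
      have heq : 2 ^ i * m + 2 ^ i * m = 2 ^ (i + 1) * m := by ring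
      rw [heq] at h
      linarith
    have hpos : (0 : ℝ) < ((2 ^ i * m : ℕ) : ℝ) := by exact_mod_cast (show 0 < 2 ^ i * m by omega)
    have hcast : ((2 ^ (i + 1) * m : ℕ) : ℝ) = 2 * ((2 ^ i * m : ℕ) : ℝ) := by push_cast; ring
    rw [Finset.sum_range_succ, hcast]
    have hdiv : b (2 ^ (i + 1) * m) / (2 * ((2 ^ i * m : ℕ) : ℝ)) ≤
        b (2 ^ i * m) / ((2 ^ i * m : ℕ) : ℝ) + φ (2 ^ (i + 1) * m) / (2 * ((2 ^ i * m : ℕ) : ℝ)) := by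
      rw [div_add_div _ _ hpos.ne' (by positivity), div_le_div_iff₀ (by positivity) (by positivity)]
      have := mul_le_mul_of_nonneg_right hstep (show (0 : ℝ) ≤ ((2 ^ i * m : ℕ) : ℝ) from hpos.le)
      nlinarith [this, hpos]
    linarith [hdiv, ih]

/-- All multiples, by induction on the binary length of the multiplier: if `τ` bounds every partial sum
`Σ_{l < i} φ (2^{l+1} m) / (2^{l+1} m)` and `φ ≥ 0` is non-decreasing, then for `1 ≤ q < 2ᵏ`,
`b (q m) ≤ q m · (b m / m + τ) + Σ_{l < k} φ (2^{l+1} m)` (each new top bit of `q` costs one defect).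
[folklore] -/
theorem mul_le_of_defect_subadditive {b φ : ℕ → ℝ} (hφ0 : ∀ n, 0 ≤ φ n) (hφm : Monotone φ)
    (hb : ∀ n m : ℕ, 2 ≤ n → 2 ≤ m → b (n + m) ≤ b n + b m + φ (n + m)) {m : ℕ} (hm : 2 ≤ m) {τ : ℝ}
    (hτ : ∀ i : ℕ, ∑ l ∈ Finset.range i, φ (2 ^ (l + 1) * m) / ((2 ^ (l + 1) * m : ℕ) : ℝ) ≤ τ) (k : ℕ) :
    ∀ q : ℕ, 1 ≤ q → q < 2 ^ k →
      b (q * m) ≤ ((q * m : ℕ) : ℝ) * (b m / (m : ℝ) + τ) + ∑ l ∈ Finset.range k, φ (2 ^ (l + 1) * m) := by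
  -- dyadic blocks are bounded by `2ⁱ m · (b m / m + τ)`
  have hblock : ∀ i : ℕ, b (2 ^ i * m) ≤ ((2 ^ i * m : ℕ) : ℝ) * (b m / (m : ℝ) + τ) := by
    intro i
    have hpos : (0 : ℝ) < ((2 ^ i * m : ℕ) : ℝ) := by exact_mod_cast (show 0 < 2 ^ i * m by positivity)
    have h : b (2 ^ i * m) / ((2 ^ i * m : ℕ) : ℝ) ≤ b m / (m : ℝ) + τ := by
      linarith [dyadic_div_le_of_defect_subadditive hb hm i, hτ i]
    have h' := (div_le_iff₀ hpos).1 h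
    linarith [h']
  induction k with
  | zero => intro q hq hq'; simp at hq'; omega
  | succ k ih =>
    intro q hq hqk
    have hsum_mono : ∑ l ∈ Finset.range k, φ (2 ^ (l + 1) * m) ≤
        ∑ l ∈ Finset.range (k + 1), φ (2 ^ (l + 1) * m) := by
      rw [Finset.sum_range_succ]
      linarith [hφ0 (2 ^ (k + 1) * m)]
    by_cases hlt : q < 2 ^ k
    · linarith [ih q hq hlt, hsum_mono]
    · push Not at hlt
      -- `q = 2^k + q'` with `q' < 2^k`
      obtain ⟨q', rfl⟩ : ∃ q', q = 2 ^ k + q' := ⟨q - 2 ^ k, by omega⟩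
      have hq'lt : q' < 2 ^ k := by
        have : (2 : ℕ) ^ (k + 1) = 2 ^ k + 2 ^ k := by ring
        omega
      rcases Nat.eq_zero_or_pos q' with rfl | hq'pos
      · -- a pure dyadic block
        simp only [add_zero]
        have h := hblock k
        have hnn : (0 : ℝ) ≤ ∑ l ∈ Finset.range (k + 1), φ (2 ^ (l + 1) * m) :=
          Finset.sum_nonneg fun l _ => hφ0 _
        linarith
      · have h2k : 2 ≤ 2 ^ k * m := le_trans hm (Nat.le_mul_of_pos_left m (Nat.two_pow_pos k))
        have hq'm : 2 ≤ q' * m := le_trans hm (Nat.le_mul_of_pos_left m hq'pos)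
        have hsplit : (2 ^ k + q') * m = q' * m + 2 ^ k * m := by ring
        have hmain := hb (q' * m) (2 ^ k * m) hq'm h2k
        rw [← hsplit] at hmain
        -- the defect of the top merge: `φ (q m) ≤ φ (2^{k+1} m)`
        have hφtop : φ ((2 ^ k + q') * m) ≤ φ (2 ^ (k + 1) * m) := by
          apply hφm
          have : 2 ^ k + q' ≤ 2 ^ (k + 1) := by
            have : (2 : ℕ) ^ (k + 1) = 2 ^ k + 2 ^ k := by ring
            omega
          exact Nat.mul_le_mul_right m this
        have hih := ih q' hq'pos hq'lt
        have hbk := hblock k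
        have hcast : (((2 ^ k + q') * m : ℕ) : ℝ) = ((q' * m : ℕ) : ℝ) + ((2 ^ k * m : ℕ) : ℝ) := by
          push_cast; ring
        rw [hcast, Finset.sum_range_succ]
        nlinarith [hmain, hφtop, hih, hbk]

/-- Ratio form for all multiples: under the hypotheses of `mul_le_of_defect_subadditive`,
`b (q m) / (q m) ≤ b m / m + 3 τ` for every `q ≥ 1` (the accumulated top-bit defects are at most `2 τ · q m`).
[folklore] -/
theorem mul_div_le_of_defect_subadditive {b φ : ℕ → ℝ} (hφ0 : ∀ n, 0 ≤ φ n) (hφm : Monotone φ)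
    (hb : ∀ n m : ℕ, 2 ≤ n → 2 ≤ m → b (n + m) ≤ b n + b m + φ (n + m)) {m : ℕ} (hm : 2 ≤ m) {τ : ℝ}
    (hτ : ∀ i : ℕ, ∑ l ∈ Finset.range i, φ (2 ^ (l + 1) * m) / ((2 ^ (l + 1) * m : ℕ) : ℝ) ≤ τ)
    {q : ℕ} (hq : 1 ≤ q) :
    b (q * m) / ((q * m : ℕ) : ℝ) ≤ b m / (m : ℝ) + 3 * τ := by
  -- binary length of `q`: `2^K ≤ q < 2^(K+1)`
  set K := Nat.log 2 q with hK
  have hqK : q < 2 ^ (K + 1) := Nat.lt_pow_succ_log_self (by norm_num) q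
  have hKq : 2 ^ K ≤ q := Nat.pow_log_le_self 2 (by omega)
  have hmain := mul_le_of_defect_subadditive hφ0 hφm hb hm hτ (K + 1) q hq hqK
  have hqm_pos : (0 : ℝ) < ((q * m : ℕ) : ℝ) := by exact_mod_cast (show 0 < q * m by positivity)
  -- the accumulated defects: `Σ_{l ≤ K} φ(2^{l+1} m) ≤ 2^{K+1} m · τ ≤ 2 q m τ`
  have hdef : ∑ l ∈ Finset.range (K + 1), φ (2 ^ (l + 1) * m) ≤ 2 * ((q * m : ℕ) : ℝ) * τ := by
    have hterm : ∀ l ∈ Finset.range (K + 1), φ (2 ^ (l + 1) * m) ≤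
        ((2 ^ (K + 1) * m : ℕ) : ℝ) * (φ (2 ^ (l + 1) * m) / ((2 ^ (l + 1) * m : ℕ) : ℝ)) := by
      intro l hl
      have hl' : l + 1 ≤ K + 1 := by
        have := Finset.mem_range.1 hl
        omega
      have hden_pos : (0 : ℝ) < ((2 ^ (l + 1) * m : ℕ) : ℝ) := by
        exact_mod_cast (show 0 < 2 ^ (l + 1) * m by positivity)
      have hden_le : ((2 ^ (l + 1) * m : ℕ) : ℝ) ≤ ((2 ^ (K + 1) * m : ℕ) : ℝ) := by
        exact_mod_cast Nat.mul_le_mul_right m (Nat.pow_le_pow_right (by norm_num) hl')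
      rw [mul_div_assoc']
      rw [le_div_iff₀ hden_pos]
      exact mul_le_mul_of_nonneg_left hden_le (hφ0 _) |>.trans_eq (by ring)
    calc ∑ l ∈ Finset.range (K + 1), φ (2 ^ (l + 1) * m)
        ≤ ∑ l ∈ Finset.range (K + 1),
            ((2 ^ (K + 1) * m : ℕ) : ℝ) * (φ (2 ^ (l + 1) * m) / ((2 ^ (l + 1) * m : ℕ) : ℝ)) :=
          Finset.sum_le_sum hterm
      _ = ((2 ^ (K + 1) * m : ℕ) : ℝ) *
            ∑ l ∈ Finset.range (K + 1), φ (2 ^ (l + 1) * m) / ((2 ^ (l + 1) * m : ℕ) : ℝ) := by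
          rw [Finset.mul_sum]
      _ ≤ ((2 ^ (K + 1) * m : ℕ) : ℝ) * τ :=
          mul_le_mul_of_nonneg_left (hτ (K + 1)) (Nat.cast_nonneg _)
      _ ≤ 2 * ((q * m : ℕ) : ℝ) * τ := by
          have hτ0 : 0 ≤ τ := le_trans (by simp) (hτ 0)
          have : ((2 ^ (K + 1) * m : ℕ) : ℝ) ≤ 2 * ((q * m : ℕ) : ℝ) := by
            have h : 2 ^ (K + 1) * m ≤ 2 * (q * m) := by
              have : 2 ^ (K + 1) = 2 * 2 ^ K := by ring
              rw [this, mul_assoc]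
              exact Nat.mul_le_mul_left 2 (Nat.mul_le_mul_right m hKq)
            exact_mod_cast h
          exact mul_le_mul_of_nonneg_right this hτ0
  rw [div_le_iff₀ hqm_pos]
  nlinarith [hmain, hdef, hqm_pos]

/-- General lengths by Euclidean division (`n = q m + r`, `2 ≤ r ≤ m + 1`): under the hypotheses of
`mul_le_of_defect_subadditive` there is a constant `C` (depending on `m`) with
`b n / n ≤ b m / m + 3 τ + C / n + φ n / n` for all `n ≥ m + 2`. [folklore] -/
theorem div_le_of_defect_subadditive : ∀ (b φ : ℕ → ℝ), (∀ n : ℕ, 0 ≤ φ n) → Monotone φ → (∀ n m : ℕ, 2 ≤ n → 2 ≤ m → b (n + m) ≤ b n + b m + φ (n + m)) → ∀ (m : ℕ), 2 ≤ m → ∀ (τ : ℝ), (∀ i : ℕ, (Finset.range i).sum (fun l => φ (2 ^ (l + 1) * m) / ((2 ^ (l + 1) * m : ℕ) : ℝ)) ≤ τ) → ∃ C : ℝ, ∀ n : ℕ, m + 2 ≤ n → b n / (n : ℝ) ≤ b m / (m : ℝ) + 3 * τ + C / (n : ℝ) + φ n / (n : ℝ) := by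
  intro b φ hφ0 hφm hb m hm τ hτ
  set A : ℝ := b m / (m : ℝ) + 3 * τ with hA_def
  set Kb : ℝ := ∑ r ∈ Finset.range (m + 2), |b r| with hKb_def
  have hKb : ∀ r : ℕ, r < m + 2 → b r ≤ Kb := fun r hr =>
    (le_abs_self _).trans
      (Finset.single_le_sum (f := fun i => |b i|) (fun i _ => abs_nonneg (b i)) (Finset.mem_range.2 hr))
  refine ⟨((m : ℝ) + 2) * |A| + Kb, fun n hn => ?_⟩
  have hm0 : 0 < m := by omega
  have hnpos : (0 : ℝ) < n := by exact_mod_cast (show 0 < n by omega)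
  -- Euclidean division of `n - 2` by `m`
  set q := (n - 2) / m with hq_def
  set r := (n - 2) % m + 2 with hr_def
  have hq1 : 1 ≤ q := (Nat.le_div_iff_mul_le hm0).2 (by omega)
  have hr2 : 2 ≤ r := by omega
  have hrm : r < m + 2 := by
    have := Nat.mod_lt (n - 2) hm0
    omega
  have hn_eq : n = q * m + r := by
    have := Nat.div_add_mod (n - 2) m
    simp only [hq_def, hr_def]
    rw [mul_comm]
    omega
  have hqm2 : 2 ≤ q * m := le_trans hm (Nat.le_mul_of_pos_left m hq1)
  -- split off the remainder
  have hsplit : b n ≤ b (q * m) + b r + φ n := by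
    have h := hb (q * m) r hqm2 hr2
    rwa [← hn_eq] at h
  have hmul := mul_div_le_of_defect_subadditive hφ0 hφm hb hm hτ hq1
  have hqm_pos : (0 : ℝ) < ((q * m : ℕ) : ℝ) := by exact_mod_cast (show 0 < q * m by omega)
  have hmul' : b (q * m) ≤ ((q * m : ℕ) : ℝ) * A := by
    have h := (div_le_iff₀ hqm_pos).1 hmul
    linarith [h]
  -- `(q m) · A ≤ n · A + (m + 2) |A|` since `0 ≤ n - q m = r ≤ m + 1`
  have hqm_le : ((q * m : ℕ) : ℝ) ≤ (n : ℝ) := by exact_mod_cast (show q * m ≤ n by omega)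
  have hdiff : (n : ℝ) - ((q * m : ℕ) : ℝ) ≤ (m : ℝ) + 2 := by
    have : n - q * m ≤ m + 2 := by omega
    have h' : ((n - q * m : ℕ) : ℝ) ≤ ((m + 2 : ℕ) : ℝ) := by exact_mod_cast this
    rw [Nat.cast_sub (show q * m ≤ n by omega)] at h'
    push_cast at h' ⊢
    linarith
  have hqa : ((q * m : ℕ) : ℝ) * A ≤ (n : ℝ) * A + ((m : ℝ) + 2) * |A| := by
    have hd0 : 0 ≤ (n : ℝ) - ((q * m : ℕ) : ℝ) := by linarith [hqm_le]
    have h1 : -(((n : ℝ) - ((q * m : ℕ) : ℝ)) * A) ≤ ((n : ℝ) - ((q * m : ℕ) : ℝ)) * |A| := by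
      nlinarith [mul_nonneg hd0 (show 0 ≤ A + |A| by linarith [neg_abs_le A])]
    have h2 : ((n : ℝ) - ((q * m : ℕ) : ℝ)) * |A| ≤ ((m : ℝ) + 2) * |A| :=
      mul_le_mul_of_nonneg_right hdiff (abs_nonneg A)
    nlinarith [h1, h2]
  have key : b n ≤ (n : ℝ) * A + (((m : ℝ) + 2) * |A| + Kb) + φ n := by
    linarith [hsplit, hmul', hqa, hKb r hrm]
  calc b n / (n : ℝ) ≤ ((n : ℝ) * A + (((m : ℝ) + 2) * |A| + Kb) + φ n) / (n : ℝ) :=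
        div_le_div_of_nonneg_right key hnpos.le
    _ = A + (((m : ℝ) + 2) * |A| + Kb) / (n : ℝ) + φ n / (n : ℝ) := by
        field_simp
    _ = b m / (m : ℝ) + 3 * τ + (((m : ℝ) + 2) * |A| + Kb) / (n : ℝ) + φ n / (n : ℝ) := by
        rw [hA_def]


end Summit.AtomisticToContinuum.FouriersLaw.Theorems.EscapeDeficitDichotomy

end
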